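import Literature.NumberTheory.Sieve.BVAssemblyModuli
import HarnessLib

/-!
# Bombieri–Vinogradov over totally real fields: integrating the chain over `t`

Topic `Literature/NumberTheory/Sieve`, sub-namespace `BVAssembly` (continued). The pointwise
chain bound `G(t) ≤ P_t^d 𝓡` (`chain_at_t`) is integrated against `e^{−t d log M}`:
`P_t^d = (log 2 − a + 3)^d D₀^d (1+t)^{3d} e^{td(log 2 − a)}`, `D₀ = (1 + K₃) ε^{−3}`, and
`∫₀^∞ e^{−μt}(1+t)^n dt ≤ 1/(μ − n)`; then the sum over the moduli of the `t`-integrals of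
`‖e^{−tdlog M}(ψ_t(M;𝔮,u_𝔮) − ψ_t(M)/φ(𝔮))‖` (any choice of unit classes `u_𝔮`) is at most
`𝓡 (log 2 − a + 3)^d D₀^d / (d log M − d(log 2 − a) − 3d)`.

## References

* J. Hinz, Acta Arith. 51 (1988), §2. [cite: Hinz1988, §2 pp. 177–178]
-/

noncomputable section

open Finset NumberField NumberField.InfinitePlace MeasureTheory Set
  Literature.NumberTheory.Sieve.NumberFieldLS Literature.NumberTheory.Sieve.BoxPrimes
  Literature.NumberTheory.LFunctions Literature.NumberTheory.LFunctions.NumberField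
  Literature.NumberTheory.Sieve.CastilloEtAl2015 Literature.NumberTheory.Sieve.TypeTwoReparam
  Literature.NumberTheory.Sieve.TypeTwoBlock Literature.NumberTheory.Sieve.SmoothCoset
  Literature.NumberTheory.Sieve.SmoothBVCore Literature.NumberTheory.Sieve.SmoothBVModuli
  Literature.NumberTheory.Sieve.SmoothStepA Literature.NumberTheory.Sieve.LogIntegral
  Literature.NumberTheory.Sieve.SmoothToSharp Literature.NumberTheory.Sieve.SmoothWeights
  Literature.NumberTheory.Sieve.ProfileConst Literature.NumberTheory.Sieve.MitsuiPNT
  Literature.NumberTheory.Sieve.SmoothSmallModuli Literature.NumberTheory.Sieve.PrimRed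
  Literature.NumberTheory.Sieve.MaynardNF
open scoped Classical nonZeroDivisors

namespace Literature.NumberTheory.Sieve.BVAssembly

variable {K : Type*} [Field K] [NumberField K] [IsTotallyReal K]

local notation "d" => Module.finrank ℚ K

/-! ## Two calculus lemmas -/

omit [NumberField K] [IsTotallyReal K] in
/-- `e^{−μt}(1+t)^n ≤ e^{−(μ−n)t}` for `t ≥ 0`. [folklore] -/
theorem exp_neg_mul_pow_le {μ : ℝ} {n : ℕ} {t : ℝ} (ht : 0 ≤ t) :
    Real.exp (-(μ * t)) * (1 + t) ^ n ≤ Real.exp (-((μ - n) * t)) := by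
  have h1 : (1 + t) ^ n ≤ Real.exp (n * t) := by
    calc (1 + t) ^ n ≤ Real.exp t ^ n := pow_le_pow_left₀ (by linarith) (by linarith [Real.add_one_le_exp t]) n
      _ = Real.exp (n * t) := by rw [← Real.exp_nat_mul]
  calc Real.exp (-(μ * t)) * (1 + t) ^ n ≤ Real.exp (-(μ * t)) * Real.exp (n * t) :=
        mul_le_mul_of_nonneg_left h1 (Real.exp_pos _).le
    _ = Real.exp (-((μ - n) * t)) := by rw [← Real.exp_add]; ring_nf

omit [NumberField K] [IsTotallyReal K] in
/-- `t ↦ e^{−μt}(1+t)^n` is integrable on `(0,∞)` for `μ > n`. [folklore] -/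
theorem integrableOn_exp_neg_mul_pow {μ : ℝ} {n : ℕ} (hμ : (n : ℝ) < μ) :
    Integrable (fun t : ℝ => Real.exp (-(μ * t)) * (1 + t) ^ n) (volume.restrict (Ioi 0)) := by
  have hr : 0 < μ - n := by linarith
  refine Integrable.mono' (integrableOn_exp_neg_mul hr) ?_ ?_
  · exact ((Real.continuous_exp.comp (continuous_const.mul continuous_id).neg).mul
      ((continuous_const.add continuous_id).pow n)).aestronglyMeasurable
  · refine (ae_restrict_iff' measurableSet_Ioi).2 (Filter.Eventually.of_forall fun t ht => ?_)
    have ht0 : 0 < t := ht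
    rw [Real.norm_of_nonneg (by positivity)]
    exact exp_neg_mul_pow_le ht0.le

omit [NumberField K] [IsTotallyReal K] in
/-- **`∫₀^∞ e^{−μt}(1+t)^n dt ≤ 1/(μ − n)`** for `μ > n`. [folklore] -/
theorem integral_exp_neg_mul_pow_le {μ : ℝ} {n : ℕ} (hμ : (n : ℝ) < μ) :
    ∫ t in Ioi (0 : ℝ), Real.exp (-(μ * t)) * (1 + t) ^ n ≤ 1 / (μ - n) := by
  have hr : 0 < μ - n := by linarith
  rw [← integral_exp_neg_mul hr]
  exact setIntegral_mono_on (integrableOn_exp_neg_mul_pow hμ) (integrableOn_exp_neg_mul hr) measurableSet_Ioi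
    fun t ht => exp_neg_mul_pow_le (le_of_lt ht)

omit [NumberField K] [IsTotallyReal K] in
/-- **`P_t^n = ((log 2 − a + 3)(1+K₃)ε^{−3})^n (1+t)^{3n} e^{t n (log 2 − a)}`.** [folklore] -/
theorem PD_pow_eq (a ε t : ℝ) (n : ℕ) :
    PD a ε t ^ n = ((Real.log 2 - a + 3) * ((1 + K3) * (ε ^ 3)⁻¹)) ^ n * (1 + t) ^ (3 * n) *
      Real.exp ((n * (Real.log 2 - a)) * t) := by
  unfold PD kappaTD
  rw [show (Real.log 2 - a + 3) * ((1 + K3) * (ε ^ 3)⁻¹ * (1 + t) ^ 3 * Real.exp (t * (Real.log 2 - a))) =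
      ((Real.log 2 - a + 3) * ((1 + K3) * (ε ^ 3)⁻¹)) * ((1 + t) ^ 3 * Real.exp (t * (Real.log 2 - a))) by ring]
  have h1 : ((1 + t) ^ 3 * Real.exp (t * (Real.log 2 - a))) ^ n = (1 + t) ^ (3 * n) * Real.exp ((n * (Real.log 2 - a)) * t) := by
    rw [mul_pow, ← pow_mul, ← Real.exp_nat_mul]
    congr 2
    ring
  rw [mul_pow, h1]
  ring

omit [NumberField K] [IsTotallyReal K] in
/-- **`∫₀^∞ e^{−t L} P_t^n dt ≤ ((log 2 − a + 3)(1+K₃)ε^{-3})^n / (L − n(log 2 − a) − 3n)`** when the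
denominator is positive (`a ≤ 0`, `ε > 0`). [folklore] -/
theorem integral_exp_PD_pow_le {a ε L : ℝ} (ha : a ≤ 0) (hε : 0 < ε) {n : ℕ}
    (hL : (3 * n : ℝ) < L - n * (Real.log 2 - a)) :
    ∫ t in Ioi (0 : ℝ), Real.exp (-(t * L)) * PD a ε t ^ n ≤
      ((Real.log 2 - a + 3) * ((1 + K3) * (ε ^ 3)⁻¹)) ^ n / (L - n * (Real.log 2 - a) - 3 * n) := by
  set A := ((Real.log 2 - a + 3) * ((1 + K3) * (ε ^ 3)⁻¹)) ^ n with hA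
  set μ := L - n * (Real.log 2 - a) with hμ
  have hfun : (fun t : ℝ => Real.exp (-(t * L)) * PD a ε t ^ n) = fun t => A * (Real.exp (-(μ * t)) * (1 + t) ^ (3 * n)) := by
    funext t
    rw [PD_pow_eq, ← hA]
    have : Real.exp (-(t * L)) * Real.exp ((n * (Real.log 2 - a)) * t) = Real.exp (-(μ * t)) := by
      rw [← Real.exp_add, hμ]; ring_nf
    calc Real.exp (-(t * L)) * (A * (1 + t) ^ (3 * n) * Real.exp ((n * (Real.log 2 - a)) * t))
        = A * ((Real.exp (-(t * L)) * Real.exp ((n * (Real.log 2 - a)) * t)) * (1 + t) ^ (3 * n)) := by ring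
      _ = _ := by rw [this]
  rw [hfun, integral_const_mul]
  have hl2 := Real.log_pos one_lt_two
  have hK3 := K3_nonneg
  have hA0 : 0 ≤ A := by rw [hA]; exact pow_nonneg (mul_nonneg (by linarith) (by positivity)) n
  have hμn : ((3 * n : ℕ) : ℝ) < μ := by push_cast; rw [hμ]; linarith
  have h := integral_exp_neg_mul_pow_le hμn
  calc A * ∫ t in Ioi (0 : ℝ), Real.exp (-(μ * t)) * (1 + t) ^ (3 * n) ≤ A * (1 / (μ - (3 * n : ℕ))) :=
        mul_le_mul_of_nonneg_left h hA0
    _ = A / (μ - 3 * n) := by push_cast; ring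

omit [NumberField K] [IsTotallyReal K] in
/-- `t ↦ e^{−tL} P_t^n` is integrable on `(0,∞)` when `L − n(log 2 − a) > 3n`. [folklore] -/
theorem integrableOn_exp_PD_pow {a ε L : ℝ} {n : ℕ} (hL : (3 * n : ℝ) < L - n * (Real.log 2 - a)) :
    Integrable (fun t : ℝ => Real.exp (-(t * L)) * PD a ε t ^ n) (volume.restrict (Ioi 0)) := by
  set A := ((Real.log 2 - a + 3) * ((1 + K3) * (ε ^ 3)⁻¹)) ^ n with hA
  set μ := L - n * (Real.log 2 - a) with hμ
  have hfun : (fun t : ℝ => Real.exp (-(t * L)) * PD a ε t ^ n) = fun t => A * (Real.exp (-(μ * t)) * (1 + t) ^ (3 * n)) := by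
    funext t
    rw [PD_pow_eq, ← hA]
    have : Real.exp (-(t * L)) * Real.exp ((n * (Real.log 2 - a)) * t) = Real.exp (-(μ * t)) := by
      rw [← Real.exp_add, hμ]; ring_nf
    calc Real.exp (-(t * L)) * (A * (1 + t) ^ (3 * n) * Real.exp ((n * (Real.log 2 - a)) * t))
        = A * ((Real.exp (-(t * L)) * Real.exp ((n * (Real.log 2 - a)) * t)) * (1 + t) ^ (3 * n)) := by ring
      _ = _ := by rw [this]
  rw [hfun]
  have hμn : ((3 * n : ℕ) : ℝ) < μ := by push_cast; rw [hμ]; linarith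
  exact (integrableOn_exp_neg_mul_pow hμn).const_mul A

/-! ## The `t`-integrals of the class errors, summed over the moduli -/

/-- The integrand `F_{𝔮,u}(t) = e^{−t d log M}(ψ_t(M; 𝔮, u) − ψ_t(M)/φ(𝔮))`. [folklore] -/
def Fqu (a ε M : ℝ) (𝔮 : Ideal (𝓞 K)) (u : 𝓞 K ⧸ 𝔮) (t : ℝ) : ℂ :=
  (Real.exp (-(t * (d * Real.log M))) : ℂ) *
    (psiMod K (kappaT a ε t) M 𝔮 u - psiAll K (kappaT a ε t) M / (idealTotient K 𝔮 : ℂ))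

/-- `F_{𝔮,u}` is integrable on `(0,∞)`. [folklore] -/
theorem integrable_Fqu (a ε M : ℝ) (𝔮 : Ideal (𝓞 K)) (u : 𝓞 K ⧸ 𝔮) :
    Integrable (Fqu (K := K) a ε M 𝔮 u) (volume.restrict (Ioi 0)) := by
  have h1 := integrable_expFactor_mul_sum a ε ((cubeF K M).filter (fun α => Ideal.Quotient.mk 𝔮 α = u))
    (fun α hα => (Finset.mem_filter.1 hα).1) (M := M)
  have h2 := integrable_expFactor_mul_sum a ε (cubeF K M) (fun α hα => hα) (M := M)
  have h3 := h1.sub (h2.mul_const ((idealTotient K 𝔮 : ℂ))⁻¹)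
  refine h3.congr (Filter.Eventually.of_forall fun t => ?_)
  unfold Fqu psiMod psiAll
  simp only [Pi.sub_apply]
  ring

/-- **Pointwise bound by Step A**: for `𝔮 ≠ 0` and a unit class `u`,
`‖F_{𝔮,u}(t)‖ ≤ e^{−tdlog M} φ(𝔮)⁻¹ (∑_{χ≠χ₀} ‖ψ_{Ω_t}(χ)‖ + bad_t(𝔮))`. [cite: Hinz1988, §2 (2.2)] -/
theorem norm_Fqu_le (a ε M : ℝ) {𝔮 : Ideal (𝓞 K)} (h𝔮 : 𝔮 ≠ ⊥) (u : (𝓞 K ⧸ 𝔮)ˣ) (t : ℝ) :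
    ‖Fqu (K := K) a ε M 𝔮 (u : 𝓞 K ⧸ 𝔮) t‖ ≤ Real.exp (-(t * (d * Real.log M))) * ((idealTotient K 𝔮)⁻¹ *
      (∑ χ ∈ nonprincipalChars K 𝔮, ‖psiΩ K χ (kappaT a ε t) M‖ + badSum (cubeF K M) (W K (kappaT a ε t) M) 𝔮)) := by
  unfold Fqu
  rw [norm_mul, Complex.norm_real, Real.norm_of_nonneg (Real.exp_pos _).le]
  refine mul_le_mul_of_nonneg_left ?_ (Real.exp_pos _).le
  have h := stepA (K := K) (kappaT a ε t) M h𝔮 u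
  have heq : psiMod K (kappaT a ε t) M 𝔮 (u : 𝓞 K ⧸ 𝔮) - psiAll K (kappaT a ε t) M / (idealTotient K 𝔮 : ℂ) =
      psiMod K (kappaT a ε t) M 𝔮 (u : 𝓞 K ⧸ 𝔮) - ((idealTotient K 𝔮 : ℝ) : ℂ)⁻¹ * psiAll K (kappaT a ε t) M := by
    rw [div_eq_mul_inv, mul_comm (psiAll K (kappaT a ε t) M)]
  rw [heq]; exact h

/-- **The `t`-integrals summed over the moduli**: if the chain is bounded pointwise by
`P_t^d · R` for `t ≥ 0`, then for any unit classes `u_𝔮`,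
`∑_{N𝔮≤Q} ∫₀^∞ ‖F_{𝔮,u_𝔮}(t)‖ dt ≤ R ((log 2 − a + 3)(1+K₃)ε^{−3})^d / (d log M − d(log 2 − a) − 3d)`.
[cite: Hinz1988, §2 pp. 177–178] -/
theorem sum_integral_norm_Fqu_le {a ε : ℝ} (ha : a ≤ 0) (hε : 0 < ε) {M : ℝ}
    (hL : (3 * d : ℝ) < d * Real.log M - d * (Real.log 2 - a)) {Q R : ℝ} (hR : 0 ≤ R)
    (hG : ∀ t : ℝ, 0 ≤ t → ∑ 𝔮 ∈ idealsLE K Q, (idealTotient K 𝔮)⁻¹ *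
      (∑ χ ∈ nonprincipalChars K 𝔮, ‖psiΩ K χ (kappaT a ε t) M‖ + badSum (cubeF K M) (W K (kappaT a ε t) M) 𝔮) ≤
        PD a ε t ^ d * R)
    (uf : ∀ 𝔮 : Ideal (𝓞 K), (𝓞 K ⧸ 𝔮)ˣ) :
    ∑ 𝔮 ∈ idealsLE K Q, ∫ t in Ioi (0 : ℝ), ‖Fqu (K := K) a ε M 𝔮 (uf 𝔮 : 𝓞 K ⧸ 𝔮) t‖ ≤
      R * (((Real.log 2 - a + 3) * ((1 + K3) * (ε ^ 3)⁻¹)) ^ d / (d * Real.log M - d * (Real.log 2 - a) - 3 * d)) := by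
  rw [← integral_finsetSum _ fun 𝔮 _ => (integrable_Fqu a ε M 𝔮 _).norm]
  have hmaj := integrableOn_exp_PD_pow (a := a) (ε := ε) (n := d) (L := d * Real.log M) (by linarith)
  calc ∫ t in Ioi (0 : ℝ), ∑ 𝔮 ∈ idealsLE K Q, ‖Fqu (K := K) a ε M 𝔮 (uf 𝔮 : 𝓞 K ⧸ 𝔮) t‖
      ≤ ∫ t in Ioi (0 : ℝ), Real.exp (-(t * (d * Real.log M))) * PD a ε t ^ d * R := by
        refine integral_mono_of_nonneg (Filter.Eventually.of_forall fun t => Finset.sum_nonneg fun _ _ => norm_nonneg _)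
          (hmaj.mul_const R) ?_
        refine (ae_restrict_iff' measurableSet_Ioi).2 (Filter.Eventually.of_forall fun t ht => ?_)
        have ht0 : 0 ≤ t := le_of_lt ht
        calc ∑ 𝔮 ∈ idealsLE K Q, ‖Fqu (K := K) a ε M 𝔮 (uf 𝔮 : 𝓞 K ⧸ 𝔮) t‖
            ≤ ∑ 𝔮 ∈ idealsLE K Q, Real.exp (-(t * (d * Real.log M))) * ((idealTotient K 𝔮)⁻¹ *
                (∑ χ ∈ nonprincipalChars K 𝔮, ‖psiΩ K χ (kappaT a ε t) M‖ + badSum (cubeF K M) (W K (kappaT a ε t) M) 𝔮)) :=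
              Finset.sum_le_sum fun 𝔮 h𝔮 => norm_Fqu_le a ε M (mem_idealsLE.1 h𝔮).1 (uf 𝔮) t
          _ = Real.exp (-(t * (d * Real.log M))) * ∑ 𝔮 ∈ idealsLE K Q, (idealTotient K 𝔮)⁻¹ *
                (∑ χ ∈ nonprincipalChars K 𝔮, ‖psiΩ K χ (kappaT a ε t) M‖ + badSum (cubeF K M) (W K (kappaT a ε t) M) 𝔮) := by
              rw [Finset.mul_sum]
          _ ≤ Real.exp (-(t * (d * Real.log M))) * (PD a ε t ^ d * R) := mul_le_mul_of_nonneg_left (hG t ht0) (Real.exp_pos _).le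
          _ = _ := by ring
    _ = (∫ t in Ioi (0 : ℝ), Real.exp (-(t * (d * Real.log M))) * PD a ε t ^ d) * R := integral_mul_const _ _
    _ ≤ ((Real.log 2 - a + 3) * ((1 + K3) * (ε ^ 3)⁻¹)) ^ d / (d * Real.log M - d * (Real.log 2 - a) - 3 * d) * R :=
        mul_le_mul_of_nonneg_right (integral_exp_PD_pow_le ha hε (by linarith)) hR
    _ = _ := by ring

/-! ## The cube error summed over the moduli -/

variable (K) in
/-- `E(A₀(M); 𝔮) := max_{(u,𝔮)=1} |π(A₀(M); 𝔮, u) − π(A₀(M))/φ(𝔮)|`. [cite: Hinz1988, §1 (1.6)] -/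
def Ecube (M : ℝ) (𝔮 : Ideal (𝓞 K)) : ℝ :=
  ⨆ u : (𝓞 K ⧸ 𝔮)ˣ, |(piP K M 𝔮 (u : 𝓞 K ⧸ 𝔮) : ℝ) - primeCount K M / idealTotient K 𝔮|

local notation "RP" => {w : InfinitePlace K // IsReal w}

omit [IsTotallyReal K] in
/-- A maximising unit class for the cube error. [folklore] -/
theorem exists_uMax (M : ℝ) (𝔮 : Ideal (𝓞 K)) (h𝔮 : 𝔮 ≠ ⊥) : ∃ u₀ : (𝓞 K ⧸ 𝔮)ˣ, ∀ u : (𝓞 K ⧸ 𝔮)ˣ,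
    |(piP K M 𝔮 (u : 𝓞 K ⧸ 𝔮) : ℝ) - primeCount K M / idealTotient K 𝔮| ≤
      |(piP K M 𝔮 (u₀ : 𝓞 K ⧸ 𝔮) : ℝ) - primeCount K M / idealTotient K 𝔮| := by
  haveI : Finite (𝓞 K ⧸ 𝔮) := Ideal.finiteQuotientOfFreeOfNeBot 𝔮 h𝔮
  exact Finite.exists_max _

omit [NumberField K] [IsTotallyReal K] in
/-- The class filter is a coset filter: `{α : α ≡ u} = {α : α − α₀ ∈ 𝔮}` for a lift `α₀` of `u`. [folklore] -/
theorem filter_class_eq (S : Finset (𝓞 K)) (𝔮 : Ideal (𝓞 K)) (α₀ : 𝓞 K) :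
    S.filter (fun α => Ideal.Quotient.mk 𝔮 α = Ideal.Quotient.mk 𝔮 α₀) = S.filter (fun α => α - α₀ ∈ 𝔮) :=
  Finset.filter_congr fun α _ => by rw [Ideal.Quotient.eq]

/-- **The cube errors summed over the moduli.** Under the abstract chain bound `hG` (with constant
`R ≥ 0`), the coset-count hypothesis `hCG` (`C_G ≥ 0`), `1 ≤ M`, `0 < ε`, `a ≤ −ε`,
`d log M − d(log 2 − a) > 3d`, `1 ≤ Q`:
`∑_{N𝔮≤Q} E(A₀(M);𝔮) ≤ R·A_ε/den + (#I(Q) + H_Q)(#PP + Layer) + ∑_𝔮 LayerCoset(𝔮)`.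
[cite: Hinz1988, §2 pp. 177–178] -/
theorem sum_Ecube_le {a ε : ℝ} (hε : 0 < ε) (haε : a ≤ -ε) {M : ℝ} (hM : 1 ≤ M)
    (hL : (3 * d : ℝ) < d * Real.log M - d * (Real.log 2 - a)) {Q R : ℝ} (hR : 0 ≤ R)
    (hG : ∀ t : ℝ, 0 ≤ t → ∑ 𝔮 ∈ idealsLE K Q, (idealTotient K 𝔮)⁻¹ *
      (∑ χ ∈ nonprincipalChars K 𝔮, ‖psiΩ K χ (kappaT a ε t) M‖ + badSum (cubeF K M) (W K (kappaT a ε t) M) 𝔮) ≤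
        PD a ε t ^ d * R)
    {CG : ℝ}
    (hCG : ∀ (𝔮 : (Ideal (𝓞 K))⁰) (N : ℝ), 1 ≤ N → ∀ (lo hi : RP → ℝ), (∀ w, lo w ≤ hi w) →
      (∀ w, hi w - lo w ≤ N) → ∀ α₀ : 𝓞 K,
      |(Nat.card {α : 𝓞 K // α ∈ cbox K lo hi ∧ α - α₀ ∈ (𝔮 : Ideal (𝓞 K))} : ℝ) -
          (∏ w, (hi w - lo w)) / (Ideal.absNorm (𝔮 : Ideal (𝓞 K)) * √|discr K|)| ≤
        CG * (1 + (N ^ d / Ideal.absNorm (𝔮 : Ideal (𝓞 K))) ^ (1 - 1 / (d : ℝ)))) :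
    ∑ 𝔮 ∈ idealsLE K Q, Ecube K M 𝔮 ≤
      R * (((Real.log 2 - a + 3) * ((1 + K3) * (ε ^ 3)⁻¹)) ^ d / (d * Real.log M - d * (Real.log 2 - a) - 3 * d)) +
      ((idealsLE K Q).card + ∑ 𝔮 ∈ idealsLE K Q, (idealTotient K 𝔮)⁻¹) * (ppSet K M).card +
      (∑ 𝔮 ∈ idealsLE K Q, (idealTotient K 𝔮)⁻¹) *
        (d * M ^ d * (ε + Real.exp a) / √|discr K| + 2 * CG * (1 + (M ^ d) ^ (1 - 1 / (d : ℝ)))) +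
      ∑ 𝔮 ∈ idealsLE K Q, (d * M ^ d * (ε + Real.exp a) / (Ideal.absNorm 𝔮 * √|discr K|) +
        2 * CG * (1 + (M ^ d / Ideal.absNorm 𝔮) ^ (1 - 1 / (d : ℝ)))) := by
  have hM0 : 0 < M := by linarith
  have ha : a ≤ 0 := by linarith
  -- the maximising classes
  have huf : ∀ 𝔮 : Ideal (𝓞 K), ∃ u₀ : (𝓞 K ⧸ 𝔮)ˣ, 𝔮 ≠ ⊥ → ∀ u : (𝓞 K ⧸ 𝔮)ˣ,
      |(piP K M 𝔮 (u : 𝓞 K ⧸ 𝔮) : ℝ) - primeCount K M / idealTotient K 𝔮| ≤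
        |(piP K M 𝔮 (u₀ : 𝓞 K ⧸ 𝔮) : ℝ) - primeCount K M / idealTotient K 𝔮| := by
    intro 𝔮
    by_cases h𝔮 : 𝔮 = ⊥
    · exact ⟨1, fun h => absurd h𝔮 h⟩
    · obtain ⟨u₀, hu₀⟩ := exists_uMax M 𝔮 h𝔮
      exact ⟨u₀, fun _ => hu₀⟩
  choose uf huf using huf
  -- per modulus
  set Lay := d * M ^ d * (ε + Real.exp a) / √|discr K| + 2 * CG * (1 + (M ^ d) ^ (1 - 1 / (d : ℝ))) with hLay
  have hper : ∀ 𝔮 ∈ idealsLE K Q, Ecube K M 𝔮 ≤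
      (∫ t in Ioi (0 : ℝ), ‖Fqu (K := K) a ε M 𝔮 (uf 𝔮 : 𝓞 K ⧸ 𝔮) t‖) +
        (1 + (idealTotient K 𝔮)⁻¹) * (ppSet K M).card + (idealTotient K 𝔮)⁻¹ * Lay +
        (d * M ^ d * (ε + Real.exp a) / (Ideal.absNorm 𝔮 * √|discr K|) + 2 * CG * (1 + (M ^ d / Ideal.absNorm 𝔮) ^ (1 - 1 / (d : ℝ)))) := by
    intro 𝔮 h𝔮
    have h𝔮0 := (mem_idealsLE.1 h𝔮).1
    haveI : Finite (𝓞 K ⧸ 𝔮) := Ideal.finiteQuotientOfFreeOfNeBot 𝔮 h𝔮0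
    have hφ := idealTotient_pos (K := K) h𝔮0
    refine ciSup_le fun u => (huf 𝔮 h𝔮0 u).trans ?_
    set u₀ := uf 𝔮 with hu₀
    -- sandwich + smooth count + norm of the integral
    have h1 := abs_count_sub_le (a := a) hε hM0 𝔮 (u₀ : 𝓞 K ⧸ 𝔮) hφ
    have h2 := abs_smoothCount_sub_le a ε M 𝔮 (u₀ : 𝓞 K ⧸ 𝔮) hφ
    have h3 : ‖∫ t in Ioi (0 : ℝ), (Real.exp (-(t * (d * Real.log M))) : ℂ) *
        (psiMod K (kappaT a ε t) M 𝔮 (u₀ : 𝓞 K ⧸ 𝔮) - psiAll K (kappaT a ε t) M / (idealTotient K 𝔮 : ℝ))‖ ≤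
        ∫ t in Ioi (0 : ℝ), ‖Fqu (K := K) a ε M 𝔮 (u₀ : 𝓞 K ⧸ 𝔮) t‖ := by
      have := norm_integral_le_integral_norm (μ := volume.restrict (Ioi (0 : ℝ))) (Fqu (K := K) a ε M 𝔮 (u₀ : 𝓞 K ⧸ 𝔮))
      unfold Fqu at this ⊢
      push_cast at this ⊢
      exact this
    -- the layers
    obtain ⟨α₀, hα₀⟩ := Ideal.Quotient.mk_surjective (u₀ : 𝓞 K ⧸ 𝔮)
    have h4 : ((((cubeF K M \ innerF K a ε M).filter (fun α => Ideal.Quotient.mk 𝔮 α = (u₀ : 𝓞 K ⧸ 𝔮))).card : ℕ) : ℝ) ≤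
        d * M ^ d * (ε + Real.exp a) / (Ideal.absNorm 𝔮 * √|discr K|) + 2 * CG * (1 + (M ^ d / Ideal.absNorm 𝔮) ^ (1 - 1 / (d : ℝ))) := by
      rw [← hα₀, filter_class_eq]
      exact card_layer_coset_le hCG h𝔮0 hM hε haε α₀
    have h5 : ((cubeF K M \ innerF K a ε M).card : ℝ) ≤ Lay := card_layer_le hCG hM hε haε
    have h5' : ((cubeF K M \ innerF K a ε M).card : ℝ) / idealTotient K 𝔮 ≤ (idealTotient K 𝔮)⁻¹ * Lay := by
      rw [div_eq_inv_mul]; exact mul_le_mul_of_nonneg_left h5 (inv_nonneg.2 hφ.le)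
    have h6 : ((ppSet K M).card : ℝ) / idealTotient K 𝔮 = (idealTotient K 𝔮)⁻¹ * (ppSet K M).card := by
      rw [div_eq_inv_mul]
    have hsum : |(piP K M 𝔮 (u₀ : 𝓞 K ⧸ 𝔮) : ℝ) - primeCount K M / idealTotient K 𝔮| ≤
        (∫ t in Ioi (0 : ℝ), ‖Fqu (K := K) a ε M 𝔮 (u₀ : 𝓞 K ⧸ 𝔮) t‖) + (ppSet K M).card + (idealTotient K 𝔮)⁻¹ * (ppSet K M).card +
          (d * M ^ d * (ε + Real.exp a) / (Ideal.absNorm 𝔮 * √|discr K|) + 2 * CG * (1 + (M ^ d / Ideal.absNorm 𝔮) ^ (1 - 1 / (d : ℝ)))) +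
          (idealTotient K 𝔮)⁻¹ * Lay := by
      rw [← h6]; linarith
    refine hsum.trans (le_of_eq ?_)
    ring
  -- sum over the moduli
  refine (Finset.sum_le_sum hper).trans ?_
  rw [Finset.sum_add_distrib, Finset.sum_add_distrib, Finset.sum_add_distrib]
  have hI := sum_integral_norm_Fqu_le ha hε hL hR hG uf
  have hmid : ∑ 𝔮 ∈ idealsLE K Q, (1 + (idealTotient K 𝔮)⁻¹) * ((ppSet K M).card : ℝ) =
      ((idealsLE K Q).card + ∑ 𝔮 ∈ idealsLE K Q, (idealTotient K 𝔮)⁻¹) * (ppSet K M).card := by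
    rw [← Finset.sum_mul, Finset.sum_add_distrib, Finset.sum_const, nsmul_eq_mul, mul_one]
  have hmid' : ∑ 𝔮 ∈ idealsLE K Q, (idealTotient K 𝔮)⁻¹ * Lay = (∑ 𝔮 ∈ idealsLE K Q, (idealTotient K 𝔮)⁻¹) * Lay := by
    rw [Finset.sum_mul]
  rw [hmid, hmid']
  linarith

end Literature.NumberTheory.Sieve.BVAssembly
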